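import HarnessLib
import Summits.CriticalPhenomena.Ising3DConformalLimit.Theorems.HarmonicMomentsIsotropyTwoPointAsymptoticIsotropyBulk
import Literature.Probability.LatticeModels.MessagerMiracleSole
import Summits.CriticalPhenomena.Ising3DConformalLimit.Theorems.PrecisionLaplacianTwoPointSpineGlueLogConvex

/-!
# Vague asymptotic isotropy of the critical `ℤ³` two-point function, XVII:
# Messager–Miracle-Solé monotonicity of the kernel of a POINTWISE pair scaling limit
(route HarmonicMomentsIsotropy, support item stmt-CriticalPhenomena-6036 `TwoPointAsymptoticIsotropy`;
third file of the pointwise line: item stmt-CriticalPhenomena-6153 `PointwiseLimit` ⇒ item 6036)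

Let `ρ(δ)²⟨σ_{[z₀/δ]}σ_{[z₁/δ]}⟩_{β_c}` converge POINTWISE at every non-coincident pair, to `S₂`, and put
`K(y) = S₂(0, y)`. On the closed positive orthant the lattice monotonicity of Messager–Miracle-Solé
passes to the pointwise limit:
* lattice iterations: `⟨σ₀σ_{x+ke_i}⟩ ≤ ⟨σ₀σ_x⟩` for `x_i ≥ 0` (tree: `SpineGlue.criticalTwoPoint_add_single_le`),
  `⟨σ₀σ_{x+ke_i-ke_j}⟩ ≤ ⟨σ₀σ_x⟩` for `x_j ≤ x_i` (`criticalTwoPoint_transfer_le`), and the combined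
  transfer-with-excess `criticalTwoPoint_le_of_transfer`;
* axis monotonicity of `K`: non-increasing in each coordinate, `K(u) ≤ K(p)` for `0 ≤ p ≤ u`
  (`kernel_le_of_add_single_pt`, `kernel_le_of_coord_le_pt`);
* transfer monotonicity of `K`: for `i ≠ j`, `0 ≤ a ≤ u_j ≤ u_i`, `η > 0`,
  `K(u + (a+η)e_i - a e_j) ≤ K(u)` (`kernel_absorb_le_pt`; the slack `η` absorbs the unit floor errors
  `⌊p⌋ - ⌊q⌋ ≤ ⌊p - q⌋ + 1` once the mesh is below `η`).
These feed the continuity of the homogeneous pointwise kernel (file XVIII).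

References: A. Messager, S. Miracle-Solé, J. Stat. Phys. 17 (1977) 245–262 [MessagerMiracleSoleJSP1977];
G. C. Hegerfeldt, Comm. Math. Phys. 57 (1977) 259–266 [Hegerfeldt1977]. No definitions are introduced.
-/

noncomputable section

namespace Summit.CriticalPhenomena.Ising3DConformalLimit.HarmonicMomentsIsotropyTwoPoint

open Literature.Probability.LatticeModels Literature.MathematicalPhysics.QuantumFieldTheory Filter Set
open scoped Topology
open Summit.CriticalPhenomena.Ising3DConformalLimit.HyperoctahedralRPTwoPoint
open Summit.CriticalPhenomena.Ising3DConformalLimit.RotationUpgradeFromTwoPointNegative (abs_apply_le_norm)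
open Summit.CriticalPhenomena.Ising3DConformalLimit.Theorems.SpineGlue (criticalTwoPoint_add_single_le)

/-! ### Lattice monotonicity of the critical two-point function (Messager–Miracle-Solé) -/

/-- Coordinate form: if `y` agrees with `x` off `i` and `0 ≤ x_i ≤ y_i` then
`⟨σ₀σ_y⟩_{β_c} ≤ ⟨σ₀σ_x⟩_{β_c}`. [cite: MessagerMiracleSoleJSP1977, main theorem (monotonicity of ⟨σ₀σ_x⟩ under reflections)] -/
theorem criticalTwoPoint_le_of_coord_le {x y : Site 3} (i : Fin 3) (hx : 0 ≤ x i) (hle : x i ≤ y i)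
    (hrest : ∀ l, l ≠ i → y l = x l) : criticalTwoPoint 3 y ≤ criticalTwoPoint 3 x := by
  have hy : y = x + Pi.single i (((y i - x i).toNat : ℕ) : ℤ) := by
    funext l
    by_cases hl : l = i
    · subst hl
      rw [Pi.add_apply, Pi.single_eq_same, Int.toNat_of_nonneg (sub_nonneg.2 hle)]
      ring
    · rw [Pi.add_apply, Pi.single_eq_of_ne hl, add_zero, hrest l hl]
  rw [hy]
  exact criticalTwoPoint_add_single_le x i hx _

/-- Diagonal monotonicity iterated: `⟨σ₀σ_{x + k e_i - k e_j}⟩_{β_c} ≤ ⟨σ₀σ_x⟩_{β_c}` for `x_j ≤ x_i`,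
`i ≠ j`, `k ∈ ℕ`. [cite: MessagerMiracleSoleJSP1977, main theorem (monotonicity of ⟨σ₀σ_x⟩ under reflections)] -/
theorem criticalTwoPoint_transfer_le (x : Site 3) {i j : Fin 3} (hij : i ≠ j) (hx : x j ≤ x i) (k : ℕ) :
    criticalTwoPoint 3 (x + Pi.single i (k : ℤ) - Pi.single j (k : ℤ)) ≤ criticalTwoPoint 3 x := by
  induction k with
  | zero => simp
  | succ k ih =>
    set xk : Site 3 := x + Pi.single i (k : ℤ) - Pi.single j (k : ℤ) with hxk
    have hk : xk j ≤ xk i := by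
      simp only [hxk, Pi.add_apply, Pi.sub_apply, Pi.single_eq_same, Pi.single_eq_of_ne hij.symm,
        Pi.single_eq_of_ne hij]
      omega
    have hstep := messager_miracleSole_diag_holds (d := 3) (β := criticalBeta 3) (criticalBeta_nonneg 3)
      xk hij hk
    have heq : (x + Pi.single i (((k + 1 : ℕ) : ℤ)) - Pi.single j (((k + 1 : ℕ) : ℤ)) : Site 3) =
        xk + Pi.single i 1 - Pi.single j 1 := by
      rw [hxk]
      funext l
      simp only [Pi.add_apply, Pi.sub_apply, Pi.single_apply]
      split_ifs <;> push_cast <;> ring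
    rw [heq]
    exact hstep.trans ih

/-- Transfer with excess: if `x_j ≤ x_i`, `0 ≤ x_i`, `y` agrees with `x` off `{i, j}`, `y_j ≤ x_j` and
`y_i ≥ x_i + (x_j - y_j)`, then `⟨σ₀σ_y⟩_{β_c} ≤ ⟨σ₀σ_x⟩_{β_c}` (transfer `x_j - y_j` units from `j` to
`i`, then move outward along `i`). [cite: MessagerMiracleSoleJSP1977, main theorem (monotonicity of ⟨σ₀σ_x⟩ under reflections)] -/
theorem criticalTwoPoint_le_of_transfer {x y : Site 3} {i j : Fin 3} (hij : i ≠ j) (hx : x j ≤ x i)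
    (hxi : 0 ≤ x i) (hrest : ∀ l, l ≠ i → l ≠ j → y l = x l) (hyj : y j ≤ x j)
    (hyi : x i + (x j - y j) ≤ y i) : criticalTwoPoint 3 y ≤ criticalTwoPoint 3 x := by
  set k : ℕ := (x j - y j).toNat with hkdef
  have hk : (k : ℤ) = x j - y j := Int.toNat_of_nonneg (sub_nonneg.2 hyj)
  set x'' : Site 3 := x + Pi.single i (k : ℤ) - Pi.single j (k : ℤ) with hx''
  have h1 : criticalTwoPoint 3 x'' ≤ criticalTwoPoint 3 x := criticalTwoPoint_transfer_le x hij hx k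
  have hx''i : x'' i = x i + k := by
    simp [hx'', Pi.single_eq_of_ne hij]
  have hx''j : x'' j = y j := by
    simp [hx'', Pi.single_eq_of_ne hij.symm]; omega
  have h2 : criticalTwoPoint 3 y ≤ criticalTwoPoint 3 x'' := by
    refine criticalTwoPoint_le_of_coord_le i ?_ ?_ ?_
    · rw [hx''i]; omega
    · rw [hx''i]; omega
    · intro l hl
      by_cases hlj : l = j
      · subst hlj; exact hx''j.symm
      · simp [hx'', Pi.single_eq_of_ne hl, Pi.single_eq_of_ne hlj, hrest l hl hlj]
  exact h2.trans h1

/-! ### The pointwise kernel on the closed positive orthant: monotonicity -/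

variable {ρ : ℝ → ℝ} {S2 : (Fin 2 → EuclideanSpace ℝ (Fin 3)) → ℝ}

/-- The rescaled pair correlator at `(0, y)` converges to the kernel value (pointwise hypothesis).
[folklore] -/
theorem tendsto_kernel_pt
    (hlim : ∀ x ∈ NonCoincident 3 2, Tendsto (fun δ => rescaledCorrelator (criticalCorr 3) ρ 2 δ x)
      (𝓝[>] (0:ℝ)) (𝓝 (S2 x)))
    {y : EuclideanSpace ℝ (Fin 3)} (hy : y ≠ 0) :
    Tendsto (fun δ => ρ δ ^ 2 * criticalTwoPoint 3 (latticeApprox δ y)) (𝓝[>] (0:ℝ))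
      (𝓝 (S2 ![0, y])) := by
  refine (hlim _ (zero_pair_mem_nonCoincident hy)).congr fun δ => ?_
  exact rescaledCorrelator_zero_pair ρ δ y

/-- A point of the closed positive orthant dominating a non-zero point is non-zero. [folklore] -/
theorem ne_zero_of_coord_le {p w : EuclideanSpace ℝ (Fin 3)} (hp : ∀ l, 0 ≤ p l) (hp0 : p ≠ 0)
    (hw : ∀ l, p l ≤ w l) : w ≠ 0 := by
  intro h
  apply hp0
  ext l
  have h1 := hw l
  rw [h] at h1
  have h2 := hp l
  simp only [PiLp.zero_apply] at h1 ⊢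
  linarith

/-- **Axis monotonicity of the pointwise kernel**: on the closed positive orthant, increasing one
coordinate decreases `K`: `K(u + t e_i) ≤ K(u)` for `u ≥ 0` coordinatewise, `u ≠ 0`, `t ≥ 0`.
[cite: MessagerMiracleSoleJSP1977, main theorem (monotonicity of ⟨σ₀σ_x⟩ under reflections)] -/
theorem kernel_le_of_add_single_pt
    (hlim : ∀ x ∈ NonCoincident 3 2, Tendsto (fun δ => rescaledCorrelator (criticalCorr 3) ρ 2 δ x)
      (𝓝[>] (0:ℝ)) (𝓝 (S2 x)))
    {u : EuclideanSpace ℝ (Fin 3)} (hu : ∀ l, 0 ≤ u l) (hu0 : u ≠ 0) (i : Fin 3) {t : ℝ} (ht : 0 ≤ t) :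
    S2 ![0, u + t • EuclideanSpace.single i (1:ℝ)] ≤ S2 ![0, u] := by
  set v : EuclideanSpace ℝ (Fin 3) := u + t • EuclideanSpace.single i (1:ℝ) with hv
  have hvl : ∀ l, v l = u l + (if l = i then t else 0) := fun l => by
    simp [hv]
  have hv0 : v ≠ 0 := ne_zero_of_coord_le hu hu0 fun l => by
    rw [hvl]; split_ifs <;> linarith
  refine le_of_tendsto_of_tendsto (tendsto_kernel_pt hlim hv0) (tendsto_kernel_pt hlim hu0) ?_
  filter_upwards [self_mem_nhdsWithin] with δ hδ
  refine mul_le_mul_of_nonneg_left ?_ (sq_nonneg _)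
  refine criticalTwoPoint_le_of_coord_le i ?_ ?_ ?_
  · rw [latticeApprox_apply]; exact Int.floor_nonneg.2 (div_nonneg (hu i) (le_of_lt hδ))
  · rw [latticeApprox_apply, latticeApprox_apply]
    refine Int.floor_le_floor (div_le_div_of_nonneg_right ?_ (le_of_lt hδ))
    rw [hvl, if_pos rfl]; linarith
  · intro l hl
    rw [latticeApprox_apply, latticeApprox_apply, hvl, if_neg hl, add_zero]

/-- Product-order form: for `0 ≤ p ≤ u` coordinatewise with `p ≠ 0`, `K(u) ≤ K(p)`.
[cite: MessagerMiracleSoleJSP1977, main theorem (monotonicity of ⟨σ₀σ_x⟩ under reflections)] -/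
theorem kernel_le_of_coord_le_pt
    (hlim : ∀ x ∈ NonCoincident 3 2, Tendsto (fun δ => rescaledCorrelator (criticalCorr 3) ρ 2 δ x)
      (𝓝[>] (0:ℝ)) (𝓝 (S2 x)))
    {p u : EuclideanSpace ℝ (Fin 3)} (hp : ∀ l, 0 ≤ p l) (hp0 : p ≠ 0) (hpu : ∀ l, p l ≤ u l) :
    S2 ![0, u] ≤ S2 ![0, p] := by
  -- three axis steps `p → p1 → p2 → u`
  set p1 : EuclideanSpace ℝ (Fin 3) := p + (u 0 - p 0) • EuclideanSpace.single 0 (1:ℝ) with hp1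
  set p2 : EuclideanSpace ℝ (Fin 3) := p1 + (u 1 - p 1) • EuclideanSpace.single 1 (1:ℝ) with hp2
  have hp1l : ∀ l, p1 l = p l + (if l = 0 then u 0 - p 0 else 0) := fun l => by simp [hp1]
  have hp2l : ∀ l, p2 l = p1 l + (if l = 1 then u 1 - p 1 else 0) := fun l => by simp [hp2]
  have hpp1 : ∀ l, p l ≤ p1 l := fun l => by
    rw [hp1l]; have := hpu 0; split_ifs <;> linarith
  have hp1p2 : ∀ l, p1 l ≤ p2 l := fun l => by
    rw [hp2l]; have := hpu 1; split_ifs <;> linarith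
  have hp1nn : ∀ l, 0 ≤ p1 l := fun l => (hp l).trans (hpp1 l)
  have hp2nn : ∀ l, 0 ≤ p2 l := fun l => (hp1nn l).trans (hp1p2 l)
  have hp10 : p1 ≠ 0 := ne_zero_of_coord_le hp hp0 hpp1
  have hp20 : p2 ≠ 0 := ne_zero_of_coord_le hp1nn hp10 hp1p2
  have hu_eq : u = p2 + (u 2 - p2 2) • EuclideanSpace.single 2 (1:ℝ) := by
    ext l
    fin_cases l <;> simp [hp2l, hp1l]
  have h3 : S2 ![0, u] ≤ S2 ![0, p2] := by
    rw [hu_eq]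
    refine kernel_le_of_add_single_pt hlim hp2nn hp20 2 ?_
    have := hpu 2
    rw [hp2l, hp1l]
    simp only [Fin.reduceEq, if_false, add_zero, sub_nonneg]
    exact this
  have h2 : S2 ![0, p2] ≤ S2 ![0, p1] :=
    kernel_le_of_add_single_pt hlim hp1nn hp10 1 (by have := hpu 1; linarith)
  have h1 : S2 ![0, p1] ≤ S2 ![0, p] :=
    kernel_le_of_add_single_pt hlim hp hp0 0 (by have := hpu 0; linarith)
  exact h3.trans (h2.trans h1)

/-- **Transfer monotonicity of the pointwise kernel** (diagonal MMS in the limit, with slack): on the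
closed positive orthant, for `i ≠ j`, `0 ≤ a ≤ u_j ≤ u_i` and `η > 0`,
`K(u + (a + η) e_i - a e_j) ≤ K(u)`. The slack `η` absorbs the unit floor errors
`⌊p⌋ - ⌊q⌋ ≤ ⌊p - q⌋ + 1` once the mesh is below `η`.
[cite: MessagerMiracleSoleJSP1977, main theorem (monotonicity of ⟨σ₀σ_x⟩ under reflections)] -/
theorem kernel_absorb_le_pt
    (hlim : ∀ x ∈ NonCoincident 3 2, Tendsto (fun δ => rescaledCorrelator (criticalCorr 3) ρ 2 δ x)
      (𝓝[>] (0:ℝ)) (𝓝 (S2 x)))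
    {u : EuclideanSpace ℝ (Fin 3)} (hu : ∀ l, 0 ≤ u l) (hu0 : u ≠ 0) {i j : Fin 3} (hij : i ≠ j)
    {a η : ℝ} (ha : 0 ≤ a) (haj : a ≤ u j) (hji : u j ≤ u i) (hη : 0 < η) :
    S2 ![0, u + (a + η) • EuclideanSpace.single i (1:ℝ) - a • EuclideanSpace.single j (1:ℝ)] ≤
      S2 ![0, u] := by
  set v : EuclideanSpace ℝ (Fin 3) :=
    u + (a + η) • EuclideanSpace.single i (1:ℝ) - a • EuclideanSpace.single j (1:ℝ) with hv
  have hvi : v i = u i + (a + η) := by simp [hv, hij]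
  have hvj : v j = u j - a := by simp [hv, hij.symm]
  have hvl : ∀ l, l ≠ i → l ≠ j → v l = u l := fun l hli hlj => by simp [hv, hli, hlj]
  have hv0 : v ≠ 0 := by
    intro h
    have h1 := congrArg (fun w : EuclideanSpace ℝ (Fin 3) => w i) h
    simp only [hvi, PiLp.zero_apply] at h1
    have := hu i
    linarith
  refine le_of_tendsto_of_tendsto (tendsto_kernel_pt hlim hv0) (tendsto_kernel_pt hlim hu0) ?_
  have hm : Set.Ioc (0:ℝ) η ∈ 𝓝[>] (0:ℝ) := Ioc_mem_nhdsGT hη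
  filter_upwards [hm] with δ hδ
  have hδ0 : 0 < δ := hδ.1
  refine mul_le_mul_of_nonneg_left ?_ (sq_nonneg _)
  -- the integer inequalities
  have hxi : 0 ≤ ⌊u i / δ⌋ := Int.floor_nonneg.2 (div_nonneg (hu i) hδ0.le)
  have hxji : ⌊u j / δ⌋ ≤ ⌊u i / δ⌋ := Int.floor_le_floor (div_le_div_of_nonneg_right hji hδ0.le)
  have hyj : ⌊(u j - a) / δ⌋ ≤ ⌊u j / δ⌋ :=
    Int.floor_le_floor (div_le_div_of_nonneg_right (by linarith) hδ0.le)
  have hdiff : ⌊u j / δ⌋ - ⌊(u j - a) / δ⌋ ≤ ⌊a / δ⌋ + 1 := by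
    have h := Int.le_floor_add_floor (a / δ) ((u j - a) / δ)
    have heq : a / δ + (u j - a) / δ = u j / δ := by rw [← add_div]; ring_nf
    rw [heq] at h
    omega
  have hyi : ⌊u i / δ⌋ + (⌊a / δ⌋ + 1) ≤ ⌊(u i + (a + η)) / δ⌋ := by
    have h1 : ⌊u i / δ⌋ + ⌊(a + η) / δ⌋ ≤ ⌊(u i + (a + η)) / δ⌋ := by
      have := Int.le_floor_add (u i / δ) ((a + η) / δ)
      rwa [← add_div] at this
    have h2 : ⌊a / δ⌋ + 1 ≤ ⌊(a + η) / δ⌋ := by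
      rw [← Int.floor_add_one]
      refine Int.floor_le_floor ?_
      rw [add_div]
      have : 1 ≤ η / δ := by rw [le_div_iff₀ hδ0, one_mul]; exact hδ.2
      linarith
    omega
  refine criticalTwoPoint_le_of_transfer (x := latticeApprox δ u) (y := latticeApprox δ v) hij ?_ ?_
    ?_ ?_ ?_
  · rw [latticeApprox_apply, latticeApprox_apply]; exact hxji
  · rw [latticeApprox_apply]; exact hxi
  · intro l hli hlj
    rw [latticeApprox_apply, latticeApprox_apply, hvl l hli hlj]
  · rw [latticeApprox_apply, latticeApprox_apply, hvj]; exact hyj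
  · rw [latticeApprox_apply, latticeApprox_apply, latticeApprox_apply, latticeApprox_apply, hvj, hvi]
    omega

end Summit.CriticalPhenomena.Ising3DConformalLimit.HarmonicMomentsIsotropyTwoPoint

end
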